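import Summits.QuantumFields.BalabanUV.Beta.MixedJetWardSingle
import Summits.QuantumFields.BalabanUV.Beta.RootedMixedTableLaw
import Summits.QuantumFields.BalabanUV.Beta.WardSiteToBlock
import Summits.QuantumFields.BalabanUV.Beta.MixedWardPacking

/-!
# `BalabanUV.Beta.MixedWardSiteLaw` — binder row D1, «GAUGE-LETTERS» (G4-M, part 2): **an1's SITE-LEVEL MIXED WARD LAW (W2-M) IS A THEOREM;
# THE BOND-LEVEL LAW (WM-bond) AND THE ROW's THREE MIXED WARD BINDERS AT THE Λ-LOCK `cΛ = 2∕Lc⁴` — DISCHARGED**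
# (β sub-cell, BINDER-OWNERS row D1 OWNER, lineage an2 gen 21)

HONEST FRAMING (cell charter, verbatim): «discharging BetaPertH makes Balaban's UV stability UNCONDITIONAL — a real
constructive-QFT result; it is NOT the continuum limit and NOT the Clay problem.»
HONEST DEPENDENCY: continuum YM on T⁴ ⇐ BetaPertH ∧ nine spine estimates (0/9 proved); BetaPertH ⇐ (D1) ∧ (D4) ∧ CAP+tail;
G-an2-4 gates asym, D1 and NE2/3/4.
DERIVED cell leaf ([folklore] letter algebra and `4 × 4` word evaluation), BY NAME over G4-M part 1 `MixedJetWardSingle.MjetAt_gauge_single`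
(⟸ G2 `MixedJetWard.MjetAt_gauge_counts` ⟸ G1 `RootedGaugeCovariance.PhiGAt_gauge`, the group-level gauge covariance of the rooted averaging),
an3-g33's `RootedMixedJetLinear` (`MjetAt_sum_B`, `MjetAt_sub_B`) and `RootedMixedTableLaw` (33M4: the `(0,3)` entries `ent_X1_a`, `ent_X2_a`,
`ent_X1_ap`, `ent_X2_ap`, `ite_entry`; `bondLaw` = the mixed REFLECTION bond law `hMb`), node 12b `AveragingMixedJetTables` (`UT`, `E`, `aTab`,
`apTab`, `tTab`, `mixKerAt`), node 7aρ (`hessCountAt_swap`, `hessKerAt`), leaf-05-g7's `WardSiteToBlock` (WX5: `bondWardM_of_siteWardM`,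
`symmetries_JsRowD1Pin_of_siteLaws`) and the owner's K-W1 `MixedWardPacking.mixedWardBinders_of_bondLaw`.  No statement of Bałaban's papers,
no `[cite:]`, no `def`, no `Prop` fact.  NOT D1, NOT `BetaPertH`, NOT continuum, NOT Clay.

WHAT (`r = L·y + ρ` the root of the block `b = (μ, y)`; `h = hessCountAt`, `q = linCountAt`; `χ_z := [u = z]`):
* §1 `dInd_smul_eq_sum`: the gauge datum of the SITE INDICATOR `λ = δ_u` is minus the divergence stencil at `u`:
  `(dδ_u)•D = Σ_κ (single (κ, u − e_κ) D − single (κ, u) D)`; `rootComm_eq`, `comm_smul_right`: scalar bookkeeping; the ten new `(0,3)` entries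
  `ent_W3_a₁…₄`, `ent_W4_a`, `ent_W3_ap₁…₄`, `ent_W4_ap`.
* §2 **THE SITE WARD LAWS OF node 12b's TABLES** (`(L : ℚ) ≠ 0`, general `d`, any root): `aTab_siteWard`
  `Σ_κ (a(f,(κ,u−e_κ),f′) − a(f,(κ,u),f′)) = (2L^d)⁻¹·h(f,f′)·(χ_r − χ_{x_{f′}}) + [f = f′]·q(f)·(L^{-d}·½·χ_{x_f} − (2L^d)⁻¹·χ_{x_{f′}})`,
  `apTab_siteWard` `= (2L^d)⁻¹·(h(f′,f)·χ_{x_f} + h(f,f′)·χ_{x_{f′}}) + [f = f′]·q(f)·((2L^d)⁻¹·(χ_{x_f} + χ_{x_{f′}}) − L^{-d}·χ_{x_f})`, and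
  **`tTab_siteWard`**: `Σ_κ (t(f,f′;(κ,u−e_κ)) − t(f,f′;(κ,u))) = 2·((2L^d)⁻¹·h(f,f′))·(χ_r − χ_{x_f})` — every `q`-contact CANCELS
  (`½·L^{-d} − (2L^d)⁻¹ = 0`, `2·(2L^d)⁻¹ − L^{-d} = 0`) and the commutator doubles by `hessCountAt_swap`.
* §3 **(W2-M) IN KERNEL CURRENCY** `mixKerAt_siteWard` (real cast, general `d`) and **`siteWardM`**: WX5's hypothesis `hSM` ∕ `hS` of
  `bondWardM_of_siteWardM` at `d = 4`, root `ρ_c = toSite (ctrOff 4 Lc)`, VERBATIM — a theorem for every `Lc ≠ 0`.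
* §4 **DISCHARGES**: `bondWardM` = K-W1's (WM-bond) ∕ RX's `hWM` at `cΛ = 2∕Lc⁴` (WX5 `bondWardM_of_siteWardM`); `mixedWardBinders` = the three
  mixed Ward binders (`hclsW₀`, `hRW₀p`, `hM₂0`) of the row END for `RW₀ := RWof Lc (2∕Lc⁴)` UNCONDITIONALLY (K-W1); and
  **`symmetries_JsRowD1Pin_of_borderLaws`**: hW ∧ hR for the literal of record `JsRowD1Pin hLc N` ⟸ the two BORDER identities only
  (reflection bond law `hBb`, site Ward law (W2-B)) — the mixed pair (`hMb` by an3's 33M4 `bondLaw`, (W2-M) here) is GONE.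
HONEST: after this file the hW∕hR wall of row D1 for `JsRowD1Pin` is EXACTLY the border pair {`hBb`, (W2-B)}; `D1Tel`, `D1Rep` untouched;
0∕4 binders of the END are discharged outright (hW and hR each still need their border half).  NOT D1, NOT BetaPertH, NOT continuum, NOT Clay.
Provenance: β sub-cell, unit beta-an2 gen 21, 2026-08-20 (v1); no existing file touched.
-/

open Finset
open scoped BigOperators
open Literature.MathematicalPhysics.QuantumFieldTheory
open Literature.MathematicalPhysics.QuantumFieldTheory.Balaban1983to89
open Literature.MathematicalPhysics.QuantumFieldTheory.Balaban1983to89.Beta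
open AffineAveraging (Form1 Site box toSite)
open AveragingContoursRooted (ctr ctrOff linAvgAt)
open AveragingHessianKernels (Bond single single_apply)
open AveragingHessianKernelsRooted (linCountAt hessCountAt hessCountAt_swap linKerAt hessKerAt vhKerAt hessKerAt_swap)
open AveragingMixedJetTables (MjetAt UT E aTab apTab tTab mixKerAt vh2KerAt mixFFAt)
open ExpKernelCalculus (MKer VertexFamily comp)
open KernelWard (divV)
open BalabanStepW2 (M2Of)
open BalabanStepJetsSucc (wVH)
open PolarizationSign (reflSign WardTransversal AxisReflectionCovariant)
open ResolventReflection (bref)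
open OneStepKernelFamily (TbalOf flipK)
open Summit.QuantumFields.BalabanUV.Beta.TameKernelCalculus (trK)
open Summit.QuantumFields.BalabanUV.Beta.BorderedHessian (diagK stepScale sgnK)
open Summit.QuantumFields.BalabanUV.Beta.AveragingWardRootedStencils (legInd)
open Summit.QuantumFields.BalabanUV.Beta.SpineRooted (M1At)
open Summit.QuantumFields.BalabanUV.Beta.RowD1JointEnd (JsRowD1Pin)
open Summit.QuantumFields.BalabanUV.Beta.MixedWardPacking (RWof mixedWardBinders_of_bondLaw)
open Summit.QuantumFields.BalabanUV.Beta.RootedMixedJetLinear (MjetAt_sum_B MjetAt_sub_B)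
open Summit.QuantumFields.BalabanUV.Beta.MixedJetWardSingle (MjetAt_gauge_single)
open Summit.QuantumFields.BalabanUV.Beta.RootedMixedTableLaw (ent_X1_a ent_X2_a ent_X1_ap ent_X2_ap ite_entry bondLaw)
open Summit.QuantumFields.BalabanUV.Beta.WardSiteToBlock (bondWardM_of_siteWardM symmetries_JsRowD1Pin_of_siteLaws)

namespace Summit.QuantumFields.BalabanUV.Beta.MixedWardSiteLaw

/-! ## §1 The indicator gauge datum in letters; scalar bookkeeping; four `(0,3)` entries -/

section Letters

variable {𝕜 : Type*} [Field 𝕜] {d : ℕ} {𝔸 : Type*} [Ring 𝔸] [Algebra 𝕜 𝔸]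

open Classical in
/-- [folklore] **THE GAUGE DATUM OF THE SITE INDICATOR `λ = δ_u` IN LETTERS**: `(dδ_u)•D = Σ_κ (single (κ, u − e_κ) D − single (κ, u) D)`
(minus the divergence stencil at `u`, letter `D`). -/
theorem dInd_smul_eq_sum (u : Site d) (D : 𝔸) :
    (fun (κ : Fin d) (x : Site d) =>
        ((if u = x + AffineAveraging.unitVec κ then (1 : 𝕜) else 0) - (if u = x then (1 : 𝕜) else 0)) • D)
      = ∑ κ : Fin d, (single (κ, u - AffineAveraging.unitVec κ) D - single (κ, u) D) := by
  funext κ x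
  simp only [Finset.sum_apply, Pi.sub_apply, single_apply, Prod.mk.injEq, ite_and, Finset.sum_sub_distrib, Finset.sum_ite_eq,
    Finset.mem_univ, if_true]
  have e1 : (x = u - AffineAveraging.unitVec κ) ↔ (u = x + AffineAveraging.unitVec κ) := by rw [eq_sub_iff_add_eq, eq_comm]
  have e2 : (x = u) ↔ (u = x) := eq_comm
  simp only [e1, e2, sub_smul, ite_smul, one_smul, zero_smul]

/-- [folklore] `[a, s•b] = s•[a, b]`. -/
theorem comm_smul_right (s : 𝕜) (a b : 𝔸) : AveragingHessianKernels.comm a (s • b) = s • AveragingHessianKernels.comm a b := by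
  simp only [AveragingHessianKernels.comm, mul_smul_comm, smul_mul_assoc, smul_sub]

/-- [folklore] The root commutator in scalar form: `(s•D)(c•(n•X)) − (c•(n•X))(s•D) = (s·c·n)•[D, X]`. -/
theorem rootComm_eq (s c : 𝕜) (n : ℤ) (D X : 𝔸) :
    (s • D) * (c • (n • X)) - (c • (n • X)) * (s • D) = (s * c * (n : 𝕜)) • AveragingHessianKernels.comm D X := by
  rw [← Int.cast_smul_eq_zsmul 𝕜 n X]
  simp only [AveragingHessianKernels.comm, smul_mul_assoc, mul_smul_comm, smul_smul, smul_sub]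
  congr 1 <;> ring_nf

end Letters

section Entries

/-- [folklore] `((½(E₀₁E₁₂ + E₁₂E₀₁))·E₂₃)₀₃ = ½` (first piece of the `τ₁τ₂`-word at the `a`-letters). -/
theorem ent_W3_a₁ : (((2 : ℚ)⁻¹ • (E 0 1 * E 1 2 + E 1 2 * E 0 1)) * E 2 3) 0 3 = 2⁻¹ := by
  simp [E]

/-- [folklore] `(E₂₃·½(E₀₁E₁₂ + E₁₂E₀₁))₀₃ = 0`. -/
theorem ent_W3_a₂ : (E 2 3 * ((2 : ℚ)⁻¹ • (E 0 1 * E 1 2 + E 1 2 * E 0 1))) 0 3 = 0 := by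
  simp [E]

/-- [folklore] `(E₀₁E₂₃E₁₂)₀₃ = 0`. -/
theorem ent_W3_a₃ : (E 0 1 * E 2 3 * E 1 2) 0 3 = 0 := by
  simp [E]

/-- [folklore] `(E₁₂E₂₃E₀₁)₀₃ = 0`. -/
theorem ent_W3_a₄ : (E 1 2 * E 2 3 * E 0 1) 0 3 = 0 := by
  simp [E]

/-- [folklore] `[E₂₃, [E₀₁, E₁₂]]₀₃ = −1` (the root word at the `a`-letters). -/
theorem ent_W4_a : (AveragingHessianKernels.comm (E 2 3) (AveragingHessianKernels.comm (E 0 1) (E 1 2))) 0 3 = -1 := by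
  simp [AveragingHessianKernels.comm, E]

/-- [folklore] `((½(E₀₁E₂₃ + E₂₃E₀₁))·E₁₂)₀₃ = 0` (first piece of the `τ₁τ₂`-word at the `a′`-letters). -/
theorem ent_W3_ap₁ : (((2 : ℚ)⁻¹ • (E 0 1 * E 2 3 + E 2 3 * E 0 1)) * E 1 2) 0 3 = 0 := by
  simp [E]

/-- [folklore] `(E₁₂·½(E₀₁E₂₃ + E₂₃E₀₁))₀₃ = 0`. -/
theorem ent_W3_ap₂ : (E 1 2 * ((2 : ℚ)⁻¹ • (E 0 1 * E 2 3 + E 2 3 * E 0 1))) 0 3 = 0 := by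
  simp [E]

/-- [folklore] `(E₀₁E₁₂E₂₃)₀₃ = 1`. -/
theorem ent_W3_ap₃ : (E 0 1 * E 1 2 * E 2 3) 0 3 = 1 := by
  simp [E]

/-- [folklore] `(E₂₃E₁₂E₀₁)₀₃ = 0`. -/
theorem ent_W3_ap₄ : (E 2 3 * E 1 2 * E 0 1) 0 3 = 0 := by
  simp [E]

/-- [folklore] `[E₁₂, [E₀₁, E₂₃]]₀₃ = 0` (the root word at the `a′`-letters). -/
theorem ent_W4_ap : (AveragingHessianKernels.comm (E 1 2) (AveragingHessianKernels.comm (E 0 1) (E 2 3))) 0 3 = 0 := by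
  simp [AveragingHessianKernels.comm, E]

end Entries

/-! ## §2 The site Ward laws of the tables `aTab`, `apTab`, `tTab` -/

section Tables

variable {d L : ℕ} (hL : (L : ℚ) ≠ 0)
include hL

open Classical in
/-- [folklore] **THE SITE WARD LAW OF THE TABLE `aTab`** (G4-M part 1's `MjetAt_gauge_single` at `λ = δ_u`, letters `E₀₁, E₁₂, E₂₃`,
entry `(0,3)`). -/
theorem aTab_siteWard (ρ : Fin d → ℤ) (μ : Fin d) (y u : Fin d → ℤ) (f f' : Bond d) :
    ∑ κ : Fin d, (aTab ρ L μ y f (κ, u - AffineAveraging.unitVec κ) f' - aTab ρ L μ y f (κ, u) f')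
      = ((2 : ℚ) * (L : ℚ) ^ d)⁻¹ * hessCountAt ρ L μ y f f'
          * ((if u = (L : ℤ) • y + ρ then (1 : ℚ) else 0) - (if u = f'.2 then (1 : ℚ) else 0))
        + (if f = f' then
            linCountAt ρ L μ y f * (((L : ℚ) ^ d)⁻¹ * 2⁻¹ * (if u = f.2 then (1 : ℚ) else 0)
              - ((2 : ℚ) * (L : ℚ) ^ d)⁻¹ * (if u = f'.2 then (1 : ℚ) else 0)) else 0) := by
  have key := MjetAt_gauge_single (𝕜 := ℚ) (𝔸 := UT) (fun z : Site d => if u = z then (1 : ℚ) else 0) (E 2 3) hL two_ne_zero ρ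
    f f' (E 0 1) (E 1 2) μ y
  beta_reduce at key
  rw [dInd_smul_eq_sum, MjetAt_sum_B, rootComm_eq, comm_smul_right, comm_smul_right] at key
  have k := congrFun (congrFun key 0) 3
  simp only [MjetAt_sub_B, Matrix.sum_apply, Matrix.sub_apply, Matrix.add_apply, Matrix.smul_apply, ite_entry, ent_X1_a, ent_X2_a,
    ent_W3_a₁, ent_W3_a₂, ent_W3_a₃, ent_W3_a₄, ent_W4_a] at k
  have eff : (f' = f) ↔ (f = f') := eq_comm
  simp only [aTab, eff] at k ⊢
  rw [k]
  simp only [smul_eq_mul, zsmul_eq_mul, mul_zero, smul_zero, add_zero, zero_add]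
  by_cases hff : f = f'
  · subst hff
    simp only [if_true]
    split_ifs <;> ring
  · simp only [hff, if_false]
    split_ifs <;> ring

open Classical in
/-- [folklore] **THE SITE WARD LAW OF THE TABLE `apTab`** (letters `E₀₁, E₂₃, E₁₂`). -/
theorem apTab_siteWard (ρ : Fin d → ℤ) (μ : Fin d) (y u : Fin d → ℤ) (f f' : Bond d) :
    ∑ κ : Fin d, (apTab ρ L μ y f (κ, u - AffineAveraging.unitVec κ) f' - apTab ρ L μ y f (κ, u) f')
      = ((2 : ℚ) * (L : ℚ) ^ d)⁻¹
          * (hessCountAt ρ L μ y f' f * (if u = f.2 then (1 : ℚ) else 0)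
              + hessCountAt ρ L μ y f f' * (if u = f'.2 then (1 : ℚ) else 0))
        + (if f = f' then
            linCountAt ρ L μ y f * (((2 : ℚ) * (L : ℚ) ^ d)⁻¹ * ((if u = f.2 then (1 : ℚ) else 0) + (if u = f'.2 then (1 : ℚ) else 0))
              - ((L : ℚ) ^ d)⁻¹ * (if u = f.2 then (1 : ℚ) else 0)) else 0) := by
  have key := MjetAt_gauge_single (𝕜 := ℚ) (𝔸 := UT) (fun z : Site d => if u = z then (1 : ℚ) else 0) (E 1 2) hL two_ne_zero ρ
    f f' (E 0 1) (E 2 3) μ y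
  beta_reduce at key
  rw [dInd_smul_eq_sum, MjetAt_sum_B, rootComm_eq, comm_smul_right, comm_smul_right] at key
  have k := congrFun (congrFun key 0) 3
  simp only [MjetAt_sub_B, Matrix.sum_apply, Matrix.sub_apply, Matrix.add_apply, Matrix.smul_apply, ite_entry, ent_X1_ap, ent_X2_ap,
    ent_W3_ap₁, ent_W3_ap₂, ent_W3_ap₃, ent_W3_ap₄, ent_W4_ap] at k
  have eff : (f' = f) ↔ (f = f') := eq_comm
  simp only [apTab, eff] at k ⊢
  rw [k]
  simp only [smul_eq_mul, zsmul_eq_mul, mul_zero, mul_one, add_zero, sub_zero]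
  by_cases hff : f = f'
  · subst hff
    simp only [if_true]
    split_ifs <;> ring
  · simp only [hff, if_false]
    split_ifs <;> ring

open Classical in
/-- [folklore] **THE SITE WARD LAW OF THE DIAGONAL RECIPE `tTab`**: `Σ_κ (t(f,f′;(κ,u−e_κ)) − t(f,f′;(κ,u))) = 2·((2L^d)⁻¹ h(f,f′))·([u = r] − [u = x_f])`
— all `q`-contacts cancel; the commutator doubles by `hessCountAt_swap`. -/
theorem tTab_siteWard (ρ : Fin d → ℤ) (μ : Fin d) (y u : Fin d → ℤ) (f f' : Bond d) :
    ∑ κ : Fin d, (tTab ρ L μ y f f' (κ, u - AffineAveraging.unitVec κ) - tTab ρ L μ y f f' (κ, u))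
      = 2 * (((2 : ℚ) * (L : ℚ) ^ d)⁻¹ * hessCountAt ρ L μ y f f')
          * ((if u = (L : ℤ) • y + ρ then (1 : ℚ) else 0) - (if u = f.2 then (1 : ℚ) else 0)) := by
  have hs : ∀ κ : Fin d, tTab ρ L μ y f f' (κ, u - AffineAveraging.unitVec κ) - tTab ρ L μ y f f' (κ, u)
      = (aTab ρ L μ y f (κ, u - AffineAveraging.unitVec κ) f' - aTab ρ L μ y f (κ, u) f')
        + (apTab ρ L μ y f (κ, u - AffineAveraging.unitVec κ) f' - apTab ρ L μ y f (κ, u) f')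
        - (aTab ρ L μ y f' (κ, u - AffineAveraging.unitVec κ) f - aTab ρ L μ y f' (κ, u) f) := by
    intro κ
    simp only [tTab]
    ring
  rw [Finset.sum_congr rfl (fun κ _ => hs κ), Finset.sum_sub_distrib, Finset.sum_add_distrib, aTab_siteWard hL, apTab_siteWard hL,
    aTab_siteWard hL, hessCountAt_swap ρ L μ y f f']
  push_cast
  by_cases hff : f = f'
  · subst hff
    simp only [if_true]
    split_ifs <;> ring
  · have hff' : ¬ f' = f := fun h => hff h.symm
    simp only [hff, hff', if_false]
    split_ifs <;> ring

end Tables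

/-! ## §3 (W2-M) in kernel currency -/

section Kernels

variable {d : ℕ}

open Classical in
/-- [folklore] **an1's SITE-LEVEL MIXED WARD LAW (W2-M) — A THEOREM** (general `d`, any root `ρ`, `L ≠ 0`):
`Σ_κ (t_b(f,f′;(κ,u−e_κ)) − t_b(f,f′;(κ,u))) = 2·h_b(f,f′)·([u = r_b] − [u = x_f])`. -/
theorem mixKerAt_siteWard {L : ℕ} (hL : L ≠ 0) (ρ : Fin d → ℤ) (μ : Fin d) (y u : Fin d → ℤ) (f f' : Bond d) :
    ∑ κ : Fin d, (mixKerAt ρ L μ y (κ, u - AffineAveraging.unitVec κ) f f' - mixKerAt ρ L μ y (κ, u) f f')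
      = 2 * hessKerAt ρ L μ y f f' * ((if u = (L : ℤ) • y + ρ then (1 : ℝ) else 0) - (if u = f.2 then (1 : ℝ) else 0)) := by
  have hLq : (L : ℚ) ≠ 0 := Nat.cast_ne_zero.2 hL
  have h := congrArg (fun q : ℚ => (q : ℝ)) (tTab_siteWard hLq ρ μ y u f f')
  simp only [Rat.cast_sum, Rat.cast_sub, Rat.cast_mul, Rat.cast_inv, Rat.cast_pow, Rat.cast_natCast, Rat.cast_intCast,
    Rat.cast_ofNat, apply_ite (Rat.cast : ℚ → ℝ), Rat.cast_one, Rat.cast_zero] at h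
  simp only [mixKerAt, hessKerAt, div_eq_mul_inv]
  rw [h]
  ring

end Kernels

/-! ## §4 `d = 4`, root `ρ_c`: WX5's hypothesis verbatim, and the discharges -/

section Row

variable {Lc : ℕ} [NeZero Lc]

open Classical in
/-- [folklore] **(W2-M) AT `d = 4`, ROOT `ρ_c = toSite (ctrOff 4 Lc)`** — the hypothesis `hS` of WX5's `bondWardM_of_siteWardM` ∕ `hSM` of
`symmetries_JsRowD1Pin_of_siteLaws`, token for token, now a theorem. -/
theorem siteWardM :
    ∀ (u : Fin 4 → ℤ) (ρ' : Fin 4) (w : Fin 4 → ℤ) (β : Fin 4) (x : Fin 4 → ℤ) (β' : Fin 4) (x' : Fin 4 → ℤ),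
      ∑ κ : Fin (3 + 1),
          (mixKerAt (toSite (ctrOff 4 Lc)) Lc ρ' w (κ, u - B6BondElimination.unitVec κ) (β, x) (β', x')
            - mixKerAt (toSite (ctrOff 4 Lc)) Lc ρ' w (κ, u) (β, x) (β', x')) =
        2 * hessKerAt (toSite (ctrOff 4 Lc)) Lc ρ' w (β, x) (β', x')
          * ((if u = (Lc : ℤ) • w + toSite (ctrOff 4 Lc) then (1 : ℝ) else 0) - (if u = x then (1 : ℝ) else 0)) := by
  intro u ρ' w β x β' x'
  have hU : ∀ κ : Fin 4, (B6BondElimination.unitVec κ : Fin 4 → ℤ) = AffineAveraging.unitVec κ := fun κ => by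
    funext i
    simp only [B6BondElimination.unitVec, AffineAveraging.unitVec, Pi.single_apply]
  simp only [hU]
  exact mixKerAt_siteWard (NeZero.ne Lc) (toSite (ctrOff 4 Lc)) ρ' w u (β, x) (β', x')

open Classical in
/-- [folklore] **THE BOND-LEVEL MIXED WARD LAW (WM-bond) AT THE Λ-LOCK `cΛ = 2∕Lc⁴` — DISCHARGED** (K-W1's `hWM` ∕ RX's `hWM`, token for token;
WX5's block sum `bondWardM_of_siteWardM` of `siteWardM`). -/
theorem bondWardM :
    ∀ (y : Fin (3 + 1) → ℤ) (ρ' : Fin (3 + 1)) (w : Fin (3 + 1) → ℤ) (β : Fin (3 + 1)) (x : Fin (3 + 1) → ℤ) (β' : Fin (3 + 1))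
      (x' : Fin (3 + 1) → ℤ),
      ((Lc : ℝ) ^ (3 + 1))⁻¹ * (∑ v ∈ box (3 + 1) Lc, ∑ κ : Fin (3 + 1),
          ((mixKerAt (toSite (ctrOff 4 Lc)) Lc ρ' w (κ, (Lc : ℤ) • y + toSite v - B6BondElimination.unitVec κ) (β, x) (β', x')
              - mixKerAt (toSite (ctrOff 4 Lc)) Lc ρ' w (κ, (Lc : ℤ) • y + toSite v) (β, x) (β', x'))
            + (mixKerAt (toSite (ctrOff 4 Lc)) Lc ρ' w (κ, (Lc : ℤ) • y + toSite v - B6BondElimination.unitVec κ) (β', x') (β, x)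
              - mixKerAt (toSite (ctrOff 4 Lc)) Lc ρ' w (κ, (Lc : ℤ) • y + toSite v) (β', x') (β, x)))) =
        2 * ((2 / (Lc : ℝ) ^ 4) * hessKerAt (toSite (ctrOff 4 Lc)) Lc ρ' w (β, x) (β', x') *
          ((1 / 2 : ℝ) * (∑ v ∈ box (3 + 1) Lc, (if x' = (Lc : ℤ) • y + toSite v then (1 : ℝ) else 0))
            - (1 / 2 : ℝ) * (∑ v ∈ box (3 + 1) Lc, (if x = (Lc : ℤ) • y + toSite v then (1 : ℝ) else 0)))) :=
  bondWardM_of_siteWardM siteWardM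

/-- [folklore] **THE THREE MIXED WARD BINDERS OF THE ROW END (`hclsW₀`, `hRW₀p`, `hM₂0`) AT `RW₀ := RWof Lc (2∕Lc⁴)` — UNCONDITIONAL**
(K-W1's `mixedWardBinders_of_bondLaw` with its (WM-bond) hypothesis discharged by `bondWardM`). -/
theorem mixedWardBinders (hLc : 1 ≤ Lc) :
    (∃ C δ : ℝ, 0 < δ ∧ ∀ y, VertexFamily (RWof Lc (2 / (Lc : ℝ) ^ 4) y) Lc C δ)
      ∧ (∀ y ρ' w, trK (RWof Lc (2 / (Lc : ℝ) ^ 4) y ρ' w) = -sgnK (RWof Lc (2 / (Lc : ℝ) ^ 4) y ρ' w))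
      ∧ (∀ (y : Fin (3 + 1) → ℤ) (ρ' : Fin (3 + 1)) (w : Fin (3 + 1) → ℤ),
          (stepScale 3 Lc 0 * (Lc : ℝ) ^ (3 + 1))⁻¹ • ∑ v ∈ box (3 + 1) Lc,
              divV (fun κ u => M2Of 3 Lc (mixFFAt (toSite (ctrOff 4 Lc)) Lc) 0 κ u ρ' w) ((Lc : ℤ) • y + toSite v) =
            comp (M1At 3 Lc (toSite (ctrOff 4 Lc)) (2 / (Lc : ℝ) ^ 4) 0 ρ' w)
                (diagK (((1 : ℝ) / 2) • ∑ v ∈ box (3 + 1) Lc, legInd (toSite (ctrOff 4 Lc)) ((Lc : ℤ) • y + toSite v)))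
              - comp (diagK (((1 : ℝ) / 2) • ∑ v ∈ box (3 + 1) Lc, legInd (toSite (ctrOff 4 Lc)) ((Lc : ℤ) • y + toSite v)))
                (M1At 3 Lc (toSite (ctrOff 4 Lc)) (2 / (Lc : ℝ) ^ 4) 0 ρ' w)
              + RWof Lc (2 / (Lc : ℝ) ^ 4) y ρ' w) :=
  mixedWardBinders_of_bondLaw hLc (2 / (Lc : ℝ) ^ 4) bondWardM

open Classical in
/-- [folklore] **hW ∧ hR FOR THE LITERAL OF RECORD `JsRowD1Pin hLc N` FROM THE TWO BORDER IDENTITIES ONLY** — WX5's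
`symmetries_JsRowD1Pin_of_siteLaws` with its mixed pair discharged: `hMb := RootedMixedTableLaw.bondLaw hLc` (an3 33M4) and `hSM := siteWardM`
(this file).  REMAINING HYPOTHESES: the border reflection bond law `hBb` and the border site Ward law (W2-B). -/
theorem symmetries_JsRowD1Pin_of_borderLaws (hLc : Odd Lc) {N : ℕ} (hN : 2 ≤ N) (γ : ℕ → ℝ)
    (hγ : ∀ j, γ j = -((Lc : ℝ) ^ 8 / 2) * wVH 3 Lc j / (stepScale 3 Lc j * (Lc : ℝ) ^ 4))
    (hBb : ∀ (α m : Fin 4) (y : Fin 4 → ℤ) (β : Fin 4) (x : Fin 4 → ℤ) (κ : Fin 4) (u : Fin 4 → ℤ) (κ' : Fin 4) (u' : Fin 4 → ℤ),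
      reflSign α β * reflSign α κ * reflSign α κ' * reflSign α m *
          (vh2KerAt (toSite (ctrOff 4 Lc)) Lc m (bref α m y) (β, bref α β x) (κ, bref α κ u) (κ', bref α κ' u')
            + vh2KerAt (toSite (ctrOff 4 Lc)) Lc m (bref α m y) (β, bref α β x) (κ', bref α κ' u') (κ, bref α κ u))
        = (vh2KerAt (toSite (ctrOff 4 Lc)) Lc m y (β, x) (κ, u) (κ', u') + vh2KerAt (toSite (ctrOff 4 Lc)) Lc m y (β, x) (κ', u') (κ, u))
          + 2 * (vhKerAt (toSite (ctrOff 4 Lc)) Lc m y (β, x) (κ', u')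
                  * ((if m = α then linKerAt (toSite (ctrOff 4 Lc)) Lc m y (κ, u) else 0) - (if x = u ∧ β = κ ∧ κ = α then 1 else 0))
                + vhKerAt (toSite (ctrOff 4 Lc)) Lc m y (β, x) (κ, u)
                  * ((if m = α then linKerAt (toSite (ctrOff 4 Lc)) Lc m y (κ', u') else 0) - (if x = u' ∧ β = κ' ∧ κ' = α then 1 else 0))
                + linKerAt (toSite (ctrOff 4 Lc)) Lc m y (β, x)
                  * ((if m = α then linKerAt (toSite (ctrOff 4 Lc)) Lc m y (κ, u) else 0) - (if x = u ∧ β = κ ∧ κ = α then 1 else 0))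
                  * ((if m = α then linKerAt (toSite (ctrOff 4 Lc)) Lc m y (κ', u') else 0) - (if x = u' ∧ β = κ' ∧ κ' = α then 1 else 0))))
    (hSB : ∀ (u : Fin 4 → ℤ) (m : Fin 4) (y : Fin 4 → ℤ) (β : Fin 4) (x : Fin 4 → ℤ) (κ' : Fin 4) (u' : Fin 4 → ℤ),
      ∑ κ : Fin (3 + 1),
          ((1 / 2 : ℝ) * (vh2KerAt (toSite (ctrOff 4 Lc)) Lc m y (β, x) (κ, u - B6BondElimination.unitVec κ) (κ', u')
              + vh2KerAt (toSite (ctrOff 4 Lc)) Lc m y (β, x) (κ', u') (κ, u - B6BondElimination.unitVec κ))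
            - (1 / 2 : ℝ) * (vh2KerAt (toSite (ctrOff 4 Lc)) Lc m y (β, x) (κ, u) (κ', u')
              + vh2KerAt (toSite (ctrOff 4 Lc)) Lc m y (β, x) (κ', u') (κ, u))) =
        vhKerAt (toSite (ctrOff 4 Lc)) Lc m y (β, x) (κ', u')
          * ((if u = (Lc : ℤ) • y + toSite (ctrOff 4 Lc) then (1 : ℝ) else 0) - (if u = x then (1 : ℝ) else 0))) :
    (∀ j : ℕ, WardTransversal (flipK (TbalOf Lc (JsRowD1Pin hLc N) j)))
      ∧ (∀ j : ℕ, AxisReflectionCovariant (flipK (TbalOf Lc (JsRowD1Pin hLc N) j))) :=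
  symmetries_JsRowD1Pin_of_siteLaws hLc hN γ hγ (bondLaw hLc) hBb hSB siteWardM

end Row

end Summit.QuantumFields.BalabanUV.Beta.MixedWardSiteLaw
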